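import Literature.AlgebraicTopology.FundamentalGroup.SquareBoundaryLoop
import Literature.AlgebraicTopology.FundamentalGroup.CellAttachmentPi1
import Mathlib.GroupTheory.Commutator.Basic
import HarnessLib

/-!
# The boundary word of the torus square is a commutator

Topic `Literature/AlgebraicTopology/FundamentalGroup`.  Hatcher, *Algebraic Topology* (2002), §1.2,
p. 51: the torus `T = S¹ × S¹` is the square with opposite edges identified, the `2`-cell being
attached along the word `aba⁻¹b⁻¹`.  Here, for the tree's real model `T = ι → ℝ/ℤ` with two indices
(`= ComplexTorus Φ` as a space), the square of side `1` centred at a lift `c` is parametrised by the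
sup-norm unit ball of `ι → ℝ` through `projC c : x ↦ c + x/2 (mod ℤ^ι)`, and we prove:

* `projC c`, `projC_ne_center` — the scaled covering map; it omits the puncture `x₀ = projC c 0`
  on the punctured closed unit ball; `projC_coord_add_two` (period);
* `sphere_isStrongDeformationRetractOf` — the unit sphere is a strong deformation retract of the
  punctured closed unit ball (the tree's radial deformation, Hatcher proof of Prop. 1.26);
* **`fromPath_squareLoop_mem_commutator`** — the image of the square's boundary loop
  (`SquareLoop.loop`, edges `e₁ e₂ e₃ e₄` with `projC ∘ e₃ = (projC ∘ e₁)⁻¹`,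
  `projC ∘ e₄ = (projC ∘ e₂)⁻¹`) is the commutator `[b⁻¹, a⁻¹]` of the edge loops, hence lies in
  the commutator subgroup of `π₁(A, x₁)` for every `A ⊇ T ∖ {x₀}`;
* `map_mem_commutator` — group isomorphisms preserve commutator subgroups (bookkeeping).

Sequel: `PuncturedTorusCommutator.lean` (every loop near the puncture is a product of
commutators).  Everything is proved; the one definition is `projC`.

## References

* A. Hatcher, *Algebraic Topology*, CUP (2002), §1.2 p. 51 (cell structure of the torus, boundary
  word `aba⁻¹b⁻¹`), proof of Prop. 1.26 (radial deformation retraction). [HatcherAT2002]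
-/

noncomputable section

open Set Function Metric Topology unitInterval

namespace Literature.AlgebraicTopology.FundamentalGroup

namespace PuncturedTorus

open SquareLoop

/-! ### A group-theoretic helper -/

/-- A group isomorphism maps the commutator subgroup into the commutator subgroup.
[cite: HatcherAT2002, §1.1 Prop. 1.5 (used for the change-of-base-point isomorphisms)] -/
theorem map_mem_commutator {G H : Type*} [Group G] [Group H] (e : G ≃* H) {x : G}
    (hx : x ∈ commutator G) : e x ∈ commutator H := by
  rw [commutator_def] at hx ⊢
  have h : e.toMonoidHom x ∈ Subgroup.map e.toMonoidHom ⁅(⊤ : Subgroup G), (⊤ : Subgroup G)⁆ :=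
    Subgroup.mem_map_of_mem _ hx
  rw [Subgroup.map_commutator] at h
  exact Subgroup.commutator_mono le_top le_top h

/-! ### The punctured closed ball retracts onto the sphere -/

section Retract

variable {E : Type*} [NormedAddCommGroup E] [NormedSpace ℝ E] [FiniteDimensional ℝ E]

/-- **The unit sphere is a strong deformation retract of the punctured closed unit ball** of a
finite-dimensional real normed space (radial projection; the tree's
`isStrongDeformationRetractOf_union_range_diff_center` for the identity cell).
[cite: HatcherAT2002, proof of Prop. 1.26 (radial deformation retraction)] -/
theorem sphere_isStrongDeformationRetractOf :
    Homotopy.IsStrongDeformationRetractOf (sphere (0 : E) 1) (closedBall (0 : E) 1 \ {0}) := by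
  have h := isStrongDeformationRetractOf_union_range_diff_center (A := sphere (0 : E) 1)
    (⟨Subtype.val, continuous_subtype_val⟩ : C(closedBall (0 : E) 1, E)) isClosed_sphere
    (fun x ↦ mem_sphere_zero_iff_norm) Subtype.val_injective
  have hset : (sphere (0 : E) 1 ∪ range
      ((⟨Subtype.val, continuous_subtype_val⟩ : C(closedBall (0 : E) 1, E)))) \
      {((⟨Subtype.val, continuous_subtype_val⟩ : C(closedBall (0 : E) 1, E))
        ⟨0, mem_closedBall_self zero_le_one⟩)} = closedBall (0 : E) 1 \ {0} := by
    have hr : range ((⟨Subtype.val, continuous_subtype_val⟩ : C(closedBall (0 : E) 1, E))) =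
        closedBall (0 : E) 1 := by
      change range (Subtype.val : closedBall (0 : E) 1 → E) = _
      exact Subtype.range_coe
    rw [hr, union_eq_right.2 sphere_subset_closedBall]
    rfl
  rwa [hset] at h

end Retract

/-! ### The scaled covering map of the torus and the square -/

variable {ι : Type*} [Fintype ι] [DecidableEq ι]

/-- **`projC c : ℝ^ι → (ℝ/ℤ)^ι`, `x ↦ (cᵢ + xᵢ/2 mod 1)ᵢ`** — the universal covering of the real torus
rescaled so that the sup-norm unit ball `[-1,1]^ι` is a fundamental square of side `1` centred at
the lift `c`. [cite: HatcherAT2002, §1.2 p.51 (the torus as a square with edges identified)] -/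
def projC (c : ι → ℝ) : C(ι → ℝ, ι → AddCircle (1 : ℝ)) where
  toFun x i := ((c i + 2⁻¹ * x i : ℝ) : AddCircle (1 : ℝ))
  continuous_toFun := continuous_pi fun i ↦ (AddCircle.continuous_mk' (1 : ℝ)).comp
    ((continuous_const.add ((continuous_apply i).const_smul (2⁻¹ : ℝ))))

omit [Fintype ι] [DecidableEq ι] in
/-- Pointwise formula for `projC`. [cite: HatcherAT2002, §1.2 p.51] -/
@[simp] theorem projC_apply (c x : ι → ℝ) (i : ι) :
    projC c x i = ((c i + 2⁻¹ * x i : ℝ) : AddCircle (1 : ℝ)) := rfl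

omit [DecidableEq ι] in
/-- **`projC` omits the puncture on the punctured square**: for `x` in the closed unit ball,
`projC c x = projC c 0` forces `x = 0` (a coordinate `xᵢ ∈ [-1, 1]` with `xᵢ/2 ∈ ℤ` vanishes).
[cite: HatcherAT2002, §1.2 p.51] -/
theorem projC_ne_center {c x : ι → ℝ} (hx : x ∈ closedBall (0 : ι → ℝ) 1 \ {0}) :
    projC c x ≠ projC c 0 := by
  intro h
  apply hx.2
  funext i
  have hi := congrFun h i
  simp only [projC_apply, Pi.zero_apply, mul_zero, add_zero] at hi
  have h1 : (((c i + 2⁻¹ * x i - c i : ℝ)) : AddCircle (1 : ℝ)) = 0 := by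
    rw [AddCircle.coe_sub, hi, sub_self]
  obtain ⟨n, hn⟩ := (AddCircle.coe_eq_zero_iff (1 : ℝ)).1 h1
  rw [zsmul_eq_mul, mul_one, add_sub_cancel_left] at hn
  have hxi : |x i| ≤ 1 := by
    rw [← Real.norm_eq_abs]
    exact (norm_le_pi_norm x i).trans (mem_closedBall_zero_iff.1 hx.1)
  have hn1 : |(n : ℝ)| ≤ 2⁻¹ := by
    rw [hn, abs_mul, abs_of_pos (by norm_num : (0 : ℝ) < 2⁻¹)]
    linarith
  have hn0 : n = 0 := by
    have : |(n : ℝ)| < 1 := by linarith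
    rw [← Int.cast_abs] at this
    have h' : |n| < 1 := by exact_mod_cast this
    exact Int.abs_lt_one_iff.1 h'
  rw [hn0, Int.cast_zero] at hn
  have : x i = 0 := by linarith
  simpa using this

omit [Fintype ι] [DecidableEq ι] in
/-- Translating a coordinate by `2` does not change `projC` (period `1` after halving).
[cite: HatcherAT2002, §1.2 p.51] -/
theorem projC_coord_add_two (c : ι → ℝ) {x y : ι → ℝ} (h : ∀ i, y i = x i ∨ y i = x i + 2 ∨ y i = x i - 2) :
    projC c y = projC c x := by
  funext i
  simp only [projC_apply]
  rcases h i with h | h | h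
  · rw [h]
  · rw [h, show c i + 2⁻¹ * (x i + 2) = (c i + 2⁻¹ * x i) + 1 by ring, AddCircle.coe_add_period]
  · rw [h, show c i + 2⁻¹ * (x i - 2) = (c i + 2⁻¹ * x i) - 1 by ring, AddCircle.coe_sub,
      AddCircle.coe_period, sub_zero]

/-! ### The boundary word of the square is a commutator -/

omit [DecidableEq ι] in
/-- The image of the punctured closed ball lies in `A ⊇ T ∖ {x₀}`. [cite: HatcherAT2002, §1.2 p.51] -/
theorem projC_mem (c : ι → ℝ) (A : Set (ι → AddCircle (1 : ℝ))) (hA : {projC c 0}ᶜ ⊆ A)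
    {x : ι → ℝ} (hx : x ∈ closedBall (0 : ι → ℝ) 1 \ {0}) : projC c x ∈ A :=
  hA (projC_ne_center hx)

omit [DecidableEq ι] in
/-- The sphere lies in the punctured closed ball. [cite: HatcherAT2002, proof of Prop. 1.26] -/
theorem sphere_subset_diff : sphere (0 : ι → ℝ) 1 ⊆ closedBall (0 : ι → ℝ) 1 \ {0} := by
  intro x hx
  refine ⟨sphere_subset_closedBall hx, fun h ↦ ?_⟩
  rw [mem_singleton_iff] at h
  rw [h, mem_sphere_zero_iff_norm, norm_zero] at hx
  exact zero_ne_one hx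

section Word

variable {i₀ i₁ : ι} (hne : i₀ ≠ i₁) (c : ι → ℝ) (A : Set (ι → AddCircle (1 : ℝ)))
  (hA : {projC c 0}ᶜ ⊆ A)
include hne

/-- The four edges of the square, pushed to the torus and lifted into `A`: with
`a = projC ∘ e₁`, `b = projC ∘ e₂` (loops at the image `x₁` of the corners),
`projC ∘ e₃ = a⁻¹` and `projC ∘ e₄ = b⁻¹`, so that **the boundary word is `[b⁻¹, a⁻¹]`** and the
class of `projC ∘ SquareLoop.loop` lies in the commutator subgroup of `π₁(A, x₁)`.
[cite: HatcherAT2002, §1.2 p.51 (boundary word `aba⁻¹b⁻¹` of the torus)] -/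
theorem fromPath_squareLoop_mem_commutator :
    _root_.FundamentalGroup.fromPath (Path.Homotopic.Quotient.mk
      (VanKampen.liftPath A ((loop i₀).map (projC c).continuous)
        (fun t ↦ projC_mem c A hA (sphere_subset_diff (loop_mem_sphere hne t))))) ∈
      commutator (_root_.FundamentalGroup ↥A
        ⟨projC c (pt i₀ (-1) (-1)), projC_mem c A hA (sphere_subset_diff (corner_mem_sphere i₀))⟩) := by
  -- the images of the four corners coincide
  set x₁ : ↥A := ⟨projC c (pt i₀ (-1) (-1)),
    projC_mem c A hA (sphere_subset_diff (corner_mem_sphere i₀))⟩ with hx₁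
  have hk₁ : projC c (pt i₀ 1 (-1)) = projC c (pt i₀ (-1) (-1)) :=
    projC_coord_add_two c fun i ↦ by
      by_cases h : i = i₀
      · subst h; right; left; simp only [pt_apply_self]; norm_num
      · left; simp only [pt_apply_of_ne h]
  have hk₂ : projC c (pt i₀ 1 1) = projC c (pt i₀ (-1) (-1)) :=
    projC_coord_add_two c fun i ↦ by
      by_cases h : i = i₀
      · subst h; right; left; simp only [pt_apply_self]; norm_num
      · right; left; simp only [pt_apply_of_ne h]; norm_num
  have hk₃ : projC c (pt i₀ (-1) 1) = projC c (pt i₀ (-1) (-1)) :=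
    projC_coord_add_two c fun i ↦ by
      by_cases h : i = i₀
      · subst h; left; simp only [pt_apply_self]
      · right; left; simp only [pt_apply_of_ne h]; norm_num
  -- membership of the edges in the punctured ball
  have hseg : ∀ (a b a' b' : ℝ), (|a| = 1 ∧ |a'| = 1 ∧ a = a' ∧ |b| ≤ 1 ∧ |b'| ≤ 1) ∨
      (|b| = 1 ∧ |b'| = 1 ∧ b = b' ∧ |a| ≤ 1 ∧ |a'| ≤ 1) →
      ∀ t : I, Path.segment (pt i₀ a b) (pt i₀ a' b') t ∈ closedBall (0 : ι → ℝ) 1 \ {0} := by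
    intro a b a' b' h t
    apply sphere_subset_diff
    rw [segment_pt_apply, mem_sphere_zero_iff_norm]
    have ht0 := t.2.1; have ht1 := t.2.2
    rcases h with ⟨ha, ha', haa, hb, hb'⟩ | ⟨hb, hb', hbb, ha, ha'⟩
    · refine norm_pt_eq_one_left i₀ (by rw [← haa, sub_self, mul_zero, add_zero]; exact ha) ?_
      rw [abs_le] at hb hb' ⊢
      constructor <;> nlinarith [hb.1, hb.2, hb'.1, hb'.2]
    · refine norm_pt_eq_one_right hne ?_ (by rw [← hbb, sub_self, mul_zero, add_zero]; exact hb)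
      rw [abs_le] at ha ha' ⊢
      constructor <;> nlinarith [ha.1, ha.2, ha'.1, ha'.2]
  have h1 : |(1 : ℝ)| = 1 := abs_one
  have hm1 : |(-1 : ℝ)| = 1 := by norm_num
  have he₁ := hseg (-1) (-1) 1 (-1) (Or.inr ⟨hm1, hm1, rfl, hm1.le, h1.le⟩)
  have he₂ := hseg 1 (-1) 1 1 (Or.inl ⟨h1, h1, rfl, hm1.le, h1.le⟩)
  have he₃ := hseg 1 1 (-1) 1 (Or.inr ⟨h1, h1, rfl, h1.le, hm1.le⟩)
  have he₄ := hseg (-1) 1 (-1) (-1) (Or.inl ⟨hm1, hm1, rfl, h1.le, hm1.le⟩)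
  -- the four lifted edges, as loops at `x₁`
  let ℓ : ∀ {a b a' b' : ℝ} (h : ∀ t : I, Path.segment (pt i₀ a b) (pt i₀ a' b') t ∈
      closedBall (0 : ι → ℝ) 1 \ {0}) (hs : projC c (pt i₀ a b) = projC c (pt i₀ (-1) (-1)))
      (ht : projC c (pt i₀ a' b') = projC c (pt i₀ (-1) (-1))), Path x₁ x₁ :=
    fun {a b a' b'} h hs ht ↦ (VanKampen.liftPath A ((Path.segment (pt i₀ a b) (pt i₀ a' b')).map
      (projC c).continuous) (fun t ↦ projC_mem c A hA (h t))).cast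
        (Subtype.ext hs.symm) (Subtype.ext ht.symm)
  set a : Path x₁ x₁ := ℓ he₁ rfl hk₁ with ha
  set b : Path x₁ x₁ := ℓ he₂ hk₁ hk₂ with hb
  -- `e₃ ↦ a⁻¹`, `e₄ ↦ b⁻¹`
  have h₃ : ℓ he₃ hk₂ hk₃ = a.symm := by
    refine Path.ext (funext fun t ↦ Subtype.ext ?_)
    change projC c (Path.segment (pt i₀ 1 1) (pt i₀ (-1) 1) t) =
      projC c (Path.segment (pt i₀ (-1) (-1)) (pt i₀ 1 (-1)) (σ t))
    rw [segment_pt_apply, segment_pt_apply]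
    refine projC_coord_add_two c fun i ↦ ?_
    by_cases h : i = i₀
    · subst h; left; simp only [pt_apply_self, coe_symm_eq]; ring
    · right; left; simp only [pt_apply_of_ne h, coe_symm_eq]; ring
  have h₄ : ℓ he₄ hk₃ rfl = b.symm := by
    refine Path.ext (funext fun t ↦ Subtype.ext ?_)
    change projC c (Path.segment (pt i₀ (-1) 1) (pt i₀ (-1) (-1)) t) =
      projC c (Path.segment (pt i₀ 1 (-1)) (pt i₀ 1 1) (σ t))
    rw [segment_pt_apply, segment_pt_apply]
    refine projC_coord_add_two c fun i ↦ ?_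
    by_cases h : i = i₀
    · subst h; right; right; simp only [pt_apply_self, coe_symm_eq]; ring
    · left; simp only [pt_apply_of_ne h, coe_symm_eq]; ring
  -- the whole boundary loop is `(a · b) · (a⁻¹ · b⁻¹)`
  have hloop : VanKampen.liftPath A ((loop i₀).map (projC c).continuous)
      (fun t ↦ projC_mem c A hA (sphere_subset_diff (loop_mem_sphere hne t))) =
      (a.trans b).trans (a.symm.trans b.symm) := by
    rw [← h₃, ← h₄]
    refine Path.ext (funext fun t ↦ Subtype.ext ?_)
    change projC c (loop i₀ t) = (((a.trans b).trans ((ℓ he₃ hk₂ hk₃).trans (ℓ he₄ hk₃ rfl)) t :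
      ↥A) : ι → AddCircle (1 : ℝ))
    simp only [loop, Path.trans_apply, ha, hb]
    split_ifs <;> rfl
  rw [hloop, Path.Homotopic.Quotient.mk_trans, Path.Homotopic.Quotient.mk_trans,
    Path.Homotopic.Quotient.mk_trans, Path.Homotopic.Quotient.mk_symm,
    Path.Homotopic.Quotient.mk_symm]
  -- in the group: `b⁻¹ a⁻¹ b a = [b⁻¹, a⁻¹]`
  set α : _root_.FundamentalGroup ↥A x₁ :=
    _root_.FundamentalGroup.fromPath (Path.Homotopic.Quotient.mk a)
  set β : _root_.FundamentalGroup ↥A x₁ :=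
    _root_.FundamentalGroup.fromPath (Path.Homotopic.Quotient.mk b)
  have hc : β⁻¹ * α⁻¹ * (β * α) ∈ commutator (_root_.FundamentalGroup ↥A x₁) := by
    have h := Subgroup.commutator_mem_commutator (H₁ := (⊤ : Subgroup (_root_.FundamentalGroup ↥A x₁)))
      (H₂ := ⊤) (Subgroup.mem_top β⁻¹) (Subgroup.mem_top α⁻¹)
    rw [commutatorElement_def, inv_inv, inv_inv, mul_assoc] at h
    rwa [commutator_def]
  have key : _root_.FundamentalGroup.fromPath
      (((Path.Homotopic.Quotient.mk a).trans (Path.Homotopic.Quotient.mk b)).trans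
        ((Path.Homotopic.Quotient.mk a).symm.trans (Path.Homotopic.Quotient.mk b).symm)) =
      β⁻¹ * α⁻¹ * (β * α) := by
    simp only [_root_.FundamentalGroup.mul_def, _root_.FundamentalGroup.inv_def]
    rfl
  rw [key]
  exact hc

end Word

end PuncturedTorus

end Literature.AlgebraicTopology.FundamentalGroup

end
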